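import Summits.MatrixMultiplication.MatrixMultiplication.Theorems.AbelianSTPPCensusShapeCertDefs

/-!
# Abelian STPP census — kernel evaluation of the `ShapeCert` checker (C: orders 70, 71, 72, 73, 74, 75, 76, 77, 78, 79, 80, 81, 82, 83, 84, 85)

`check M = true` by `decide +kernel` (no `native_decide`), one theorem per order (per range of small orders),
so that every kernel run starts with empty caches and stays under the default heartbeat budget
(≈ 2–6 s per order below 100, up to ≈ 30 s at the orders 125 and 127).
Consumed by `…ShapeCertFinal` (`check_le_127`).
-/

set_option linter.dupNamespace false -- `MatrixMultiplication.MatrixMultiplication` (summit = problem, D-0017)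
set_option autoImplicit false

namespace Summit.MatrixMultiplication.MatrixMultiplication.Theorems.ShapeCert

/-- certificate check at order `70` (kernel evaluation) -/
theorem check_70 : check 70 = true := by decide +kernel

/-- certificate check at order `71` (kernel evaluation) -/
theorem check_71 : check 71 = true := by decide +kernel

/-- certificate check at order `72` (kernel evaluation) -/
theorem check_72 : check 72 = true := by decide +kernel

/-- certificate check at order `73` (kernel evaluation) -/
theorem check_73 : check 73 = true := by decide +kernel

/-- certificate check at order `74` (kernel evaluation) -/
theorem check_74 : check 74 = true := by decide +kernel

/-- certificate check at order `75` (kernel evaluation) -/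
theorem check_75 : check 75 = true := by decide +kernel

/-- certificate check at order `76` (kernel evaluation) -/
theorem check_76 : check 76 = true := by decide +kernel

/-- certificate check at order `77` (kernel evaluation) -/
theorem check_77 : check 77 = true := by decide +kernel

/-- certificate check at order `78` (kernel evaluation) -/
theorem check_78 : check 78 = true := by decide +kernel

/-- certificate check at order `79` (kernel evaluation) -/
theorem check_79 : check 79 = true := by decide +kernel

/-- certificate check at order `80` (kernel evaluation) -/
theorem check_80 : check 80 = true := by decide +kernel

/-- certificate check at order `81` (kernel evaluation) -/
theorem check_81 : check 81 = true := by decide +kernel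

/-- certificate check at order `82` (kernel evaluation) -/
theorem check_82 : check 82 = true := by decide +kernel

/-- certificate check at order `83` (kernel evaluation) -/
theorem check_83 : check 83 = true := by decide +kernel

/-- certificate check at order `84` (kernel evaluation) -/
theorem check_84 : check 84 = true := by decide +kernel

/-- certificate check at order `85` (kernel evaluation) -/
theorem check_85 : check 85 = true := by decide +kernel

end Summit.MatrixMultiplication.MatrixMultiplication.Theorems.ShapeCert
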